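import Summits.NavierStokesRegularity.FunctionalMining.StrainL4Production
import Summits.NavierStokesRegularity.FunctionalMining.StrainWeightedBalance
import Summits.NavierStokesRegularity.FunctionalMining.StrainViscous
import HarnessLib

/-!
# FunctionalMining — K0 row `ES.absS.q=4|T_LD|G1` HOLDS (∃κ): the `∫|S|⁴` saturating law in the kernel

Search for candidate a priori estimates; no regularity claim. Cell `pub-nsfunc`, prove seat
(gen 9). Along every zero-mean classical solution of unforced Navier–Stokes on `T³`,
`d/dt ∫|S|⁴ ≤ κ ν^{−9/5} (2ℰ) (∫|S|⁴)^{1+1/5}`, i.e.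
`∃ κ, SaturatingLaw (d := Fin 3) (torusStrainMoment 4) 5 (9/5) κ` — the strain twin of the
vorticity row `E.q=4` (`VorticityL4SaturatingLaw`, same exponents `σ = 5`, `γ = 9/5`).

Chain (every input a tree theorem): the weighted strain balance with `Ψ(s) = s²`
(`GradientTensor.hasDerivWithinAt_integral_comp_strainSqAt`, from the velocity-gradient transport
identity, Majda–Bertozzi (1.29)) and the viscous term by parts
(`GradientTensor.integral_deriv_comp_strainSqAt_mul_sum_strain_laplacian`) give
`d/dt∫|S|⁴ ≤ 4|X_N| + 4|X_P| − 4νI`, `I = ∫|S|²|∇S|²` (`Q = |S|²`), with the nonlinear source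
`X_N = ∫ Q ∑ᵢⱼSᵢⱼ∑ₖ(∂ᵢu)ₖ(∂ₖu)ⱼ` and the pressure source
`X_P = ∫ Q ∑ᵢⱼSᵢⱼ∂ᵢ∂ⱼp`; both satisfy `|X|¹⁴ ≤ K' (∫|S|⁴)⁶ ℰ⁵ I⁹` (`StrainL4Production`, via
Cauchy–Schwarz, Calderón–Zygmund for `∇u` and `∇²p`, and the codomain-generic nonlinear
Poincaré / Sobolev top node applied to the flattened strain), and Young at the weights `(9/14, 5/14)`
absorbs `I⁹` into `−4νI`.

## Main statements

* `derivWithin_B4_le` — the slice form of the `∫|S|⁴` balance.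
* `torusStrainMoment_four` — `torusStrainMoment 4 v = ∫ (|S|²)²`.
* `strainL4_saturatingLaw` — the row.
-/

noncomputable section

open MeasureTheory Finset Set
open scoped InnerProductSpace RealInnerProductSpace ContDiff

namespace Summit.NavierStokesRegularity.FunctionalMining

open Literature.Analysis.FunctionSpaces Literature.Analysis.FunctionSpaces.Torus
  Literature.Analysis.FluidPDE

namespace StrainL4

variable {d : Type*} [Fintype d] [DecidableEq d]

/-! ## 1. The `∫|S|⁴` balance at a time slice -/

omit [Fintype d] [DecidableEq d] in
/-- `(s²)' = 2s`. [folklore] -/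
theorem deriv_sq_eq (q : ℝ) : deriv (fun s : ℝ => s ^ 2) q = 2 * q := by
  rw [(hasDerivAt_pow 2 q).deriv]
  simp

omit [Fintype d] [DecidableEq d] in
/-- `(s²)'' = 2`. [folklore] -/
theorem deriv_deriv_sq_eq (q : ℝ) : deriv (deriv (fun s : ℝ => s ^ 2)) q = 2 := by
  have e : deriv (fun s : ℝ => s ^ 2) = fun s => 2 * s := funext deriv_sq_eq
  rw [e]
  simp

/-- The forcing slice of the zero force has vanishing gradient entries. [folklore] -/
theorem partialDeriv_zero_force_apply (t : ℝ) (i j : d) (x : UnitAddTorus d) :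
    Torus.partialDeriv i ((0 : ℝ → UnitAddTorus d → EuclideanSpace ℝ d) t) x j = 0 := by
  have h0 : Torus.partialDeriv i ((0 : ℝ → UnitAddTorus d → EuclideanSpace ℝ d) t) x = 0 := by
    simp [Torus.partialDeriv, Torus.lineDeriv]
  rw [h0]
  rfl

/-- **The `∫|S|⁴` balance at a time slice (unforced, `T³`)**: along a classical solution on
`[a, b] × T³` with `ν ≥ 0`, `s ↦ ∫|S(s)|⁴` is differentiable within `[a, b]` at `t` and
`d/dt ∫|S|⁴ ≤ 4|X_N| + 4|X_P| − 4ν∫|S|²∑ₖ∑ᵢⱼ(∂ₖSᵢⱼ)²` (the second viscous term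
`−2ν∫∑ₖ(∂ₖ|S|²)²` is dropped). [ours; from MajdaBertozziCUP2002 (1.29)] -/
theorem derivWithin_B4_le {a b ν : ℝ} (hab : a < b) (hν : 0 ≤ ν)
    {u : ℝ → UnitAddTorus (Fin 3) → EuclideanSpace ℝ (Fin 3)} {p : ℝ → UnitAddTorus (Fin 3) → ℝ}
    (hsol : IsClassicalNSSolutionOn (Icc a b) ν 0 u p) {t : ℝ} (ht : t ∈ Icc a b) :
    DifferentiableWithinAt ℝ (fun s => ∫ x, torusStrainSqAt (u s) x ^ 2) (Icc a b) t ∧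
      derivWithin (fun s => ∫ x, torusStrainSqAt (u s) x ^ 2) (Icc a b) t ≤
        4 * |∫ x, torusStrainSqAt (u t) x * ∑ i, ∑ j,
            (partialDeriv j (u t) x i + partialDeriv i (u t) x j) / 2 *
              ∑ k, partialDeriv i (u t) x k * partialDeriv k (u t) x j| +
        4 * |∫ x, torusStrainSqAt (u t) x * ∑ i, ∑ j,
            (partialDeriv j (u t) x i + partialDeriv i (u t) x j) / 2 *
              partialDeriv i (partialDeriv j (p t)) x| -
        4 * ν * ∫ x, torusStrainSqAt (u t) x * ∑ k, ∑ i, ∑ j,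
          ((partialDeriv k (partialDeriv j (u t)) x i +
            partialDeriv k (partialDeriv i (u t)) x j) / 2) ^ 2 := by
  have hut : IsSmooth (u t) := hsol.smooth_velocity.isSmooth_slice ht
  have hΨ : ContDiffOn ℝ ∞ (fun s : ℝ => s ^ 2) Set.univ := (contDiff_id.pow 2).contDiffOn
  have hD := GradientTensor.hasDerivWithinAt_integral_comp_strainSqAt hsol hab isOpen_univ hΨ
    (fun s _ x => Set.mem_univ _) ht
  have hUD : UniqueDiffWithinAt ℝ (Icc a b) t := uniqueDiffOn_Icc hab t ht
  refine ⟨hD.differentiableWithinAt, ?_⟩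
  rw [hD.derivWithin hUD]
  -- names
  obtain ⟨Q, hQ⟩ : ∃ Q : UnitAddTorus (Fin 3) → ℝ, Q = torusStrainSqAt (u t) := ⟨_, rfl⟩
  obtain ⟨XN, hXN⟩ : ∃ X : ℝ, X = ∫ x, torusStrainSqAt (u t) x * ∑ i, ∑ j,
      (partialDeriv j (u t) x i + partialDeriv i (u t) x j) / 2 *
        ∑ k, partialDeriv i (u t) x k * partialDeriv k (u t) x j := ⟨_, rfl⟩
  obtain ⟨XP, hXP⟩ : ∃ X : ℝ, X = ∫ x, torusStrainSqAt (u t) x * ∑ i, ∑ j,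
      (partialDeriv j (u t) x i + partialDeriv i (u t) x j) / 2 *
        partialDeriv i (partialDeriv j (p t)) x := ⟨_, rfl⟩
  obtain ⟨I, hI⟩ : ∃ I : ℝ, I = ∫ x, torusStrainSqAt (u t) x * ∑ k, ∑ i, ∑ j,
      ((partialDeriv k (partialDeriv j (u t)) x i +
        partialDeriv k (partialDeriv i (u t)) x j) / 2) ^ 2 := ⟨_, rfl⟩
  obtain ⟨I₂, hI₂⟩ : ∃ I₂ : ℝ, I₂ = ∫ x, ∑ k, partialDeriv k (torusStrainSqAt (u t)) x ^ 2 :=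
    ⟨_, rfl⟩
  have hI₂0 : 0 ≤ I₂ := by rw [hI₂]; exact integral_nonneg fun x => Finset.sum_nonneg fun k _ => sq_nonneg _
  -- the viscous term
  have hV : ∫ x, deriv (fun s : ℝ => s ^ 2) (torusStrainSqAt (u t) x) * ∑ i, ∑ j,
      (partialDeriv j (u t) x i + partialDeriv i (u t) x j) / 2 *
        partialDeriv i (Torus.laplacian (u t)) x j = -(2 * I) - I₂ := by
    rw [GradientTensor.integral_deriv_comp_strainSqAt_mul_sum_strain_laplacian hut isOpen_univ hΨ
      (fun x => Set.mem_univ _)]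
    have e1 : ∫ x, deriv (fun s : ℝ => s ^ 2) (torusStrainSqAt (u t) x) * ∑ k, ∑ i, ∑ j,
        ((partialDeriv k (partialDeriv j (u t)) x i +
          partialDeriv k (partialDeriv i (u t)) x j) / 2) ^ 2 = 2 * I := by
      rw [hI, ← integral_const_mul]
      exact integral_congr_ae (ae_of_all _ fun x => by simp only [deriv_sq_eq]; ring)
    have e2 : ∫ x, deriv (deriv (fun s : ℝ => s ^ 2)) (torusStrainSqAt (u t) x) *
        ∑ k, partialDeriv k (torusStrainSqAt (u t)) x ^ 2 = 2 * I₂ := by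
      rw [hI₂, ← integral_const_mul]
      exact integral_congr_ae (ae_of_all _ fun x => by simp only [deriv_deriv_sq_eq])
    rw [e1, e2]
    ring
  -- the pressure term
  have hP : ∫ x, deriv (fun s : ℝ => s ^ 2) (torusStrainSqAt (u t) x) * ∑ i, ∑ j,
      (partialDeriv j (u t) x i + partialDeriv i (u t) x j) / 2 *
        partialDeriv i (partialDeriv j (p t)) x = 2 * XP := by
    rw [hXP, ← integral_const_mul]
    exact integral_congr_ae (ae_of_all _ fun x => by simp only [deriv_sq_eq]; ring)
  -- the nonlinear term
  have hN : ∫ x, deriv (fun s : ℝ => s ^ 2) (torusStrainSqAt (u t) x) * ∑ i, ∑ j,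
      (partialDeriv j (u t) x i + partialDeriv i (u t) x j) / 2 *
        ∑ k, partialDeriv i (u t) x k * partialDeriv k (u t) x j = 2 * XN := by
    rw [hXN, ← integral_const_mul]
    exact integral_congr_ae (ae_of_all _ fun x => by simp only [deriv_sq_eq]; ring)
  -- the forcing term vanishes
  have hF : ∫ x, deriv (fun s : ℝ => s ^ 2) (torusStrainSqAt (u t) x) * ∑ i, ∑ j,
      (partialDeriv j (u t) x i + partialDeriv i (u t) x j) / 2 *
        partialDeriv i ((0 : ℝ → UnitAddTorus (Fin 3) → EuclideanSpace ℝ (Fin 3)) t) x j = 0 := by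
    simp only [partialDeriv_zero_force_apply, mul_zero, Finset.sum_const_zero, integral_zero]
  rw [hV, hP, hN, hF, ← hXN, ← hXP, ← hI]
  have hνI₂ : 0 ≤ ν * I₂ := mul_nonneg hν hI₂0
  nlinarith [hνI₂, le_abs_self XN, le_abs_self XP, neg_abs_le XN, neg_abs_le XP]

/-! ## 2. The saturating law -/

/-- `∫|S|⁴` in the matrix's spelling: `torusStrainMoment 4 v = ∫ (|S|²)²`. [folklore] -/
theorem torusStrainMoment_four (v : UnitAddTorus d → EuclideanSpace ℝ d) :
    torusStrainMoment 4 v = ∫ x, torusStrainSqAt v x ^ 2 := by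
  unfold torusStrainMoment
  refine integral_congr_ae (ae_of_all _ fun x => ?_)
  show torusStrainSqAt v x ^ ((4 : ℝ) / 2) = torusStrainSqAt v x ^ 2
  rw [show (4 : ℝ) / 2 = ((2 : ℕ) : ℝ) by norm_num, Real.rpow_natCast]

/-- `∫|S|² = ℰ` for smooth divergence-free fields. [folklore] -/
theorem integral_strainSqAt_eq_torusEnstrophy {v : UnitAddTorus d → EuclideanSpace ℝ d}
    (hv : IsSmooth v) (hdiv : IsDivFree v) : ∫ x, torusStrainSqAt v x = torusEnstrophy v :=
  integral_strainNormSq_eq_torusEnstrophy hv hdiv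

omit [Fintype d] [DecidableEq d] in
/-- Young bookkeeping for one source term: from `|X|¹⁴ ≤ K' B₄⁶ B₂⁵ I⁹` (`ν > 0`, everything
non-negative), `4|X| ≤ 2νI + (10/7) c ν^{−9/5} B₂ B₄^{6/5}` with `c = (K' (9/7)⁹)^{1/5}`. [ours] -/
theorem four_abs_le_of_pow_fourteen_le {X K' B₄ B₂ I ν : ℝ} (hK' : 0 ≤ K') (hB₄ : 0 ≤ B₄)
    (hB₂ : 0 ≤ B₂) (hI : 0 ≤ I) (hν : 0 < ν) (h : |X| ^ 14 ≤ K' * B₄ ^ 6 * B₂ ^ 5 * I ^ 9) :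
    4 * |X| ≤ 2 * ν * I +
      10 / 7 * ((K' * (9 / 7) ^ 9) ^ (1 / 5 : ℝ) * ν ^ (-(9 / 5 : ℝ)) * B₂ * B₄ ^ (6 / 5 : ℝ)) := by
  obtain ⟨c, hc⟩ : ∃ c : ℝ, c = (K' * (9 / 7) ^ 9) ^ (1 / 5 : ℝ) := ⟨_, rfl⟩
  have hc0 : 0 ≤ c := by rw [hc]; positivity
  obtain ⟨x, hx⟩ : ∃ x : ℝ, x = 7 / 9 * ν * I := ⟨_, rfl⟩
  obtain ⟨y, hy⟩ : ∃ y : ℝ, y = c * ν ^ (-(9 / 5 : ℝ)) * B₂ * B₄ ^ (6 / 5 : ℝ) := ⟨_, rfl⟩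
  have hx0 : 0 ≤ x := by rw [hx]; positivity
  have hνr : 0 ≤ ν ^ (-(9 / 5 : ℝ)) := Real.rpow_nonneg hν.le _
  have hy0 : 0 ≤ y := by rw [hy]; positivity
  have hxy : x ^ 9 * y ^ 5 = K' * B₄ ^ 6 * B₂ ^ 5 * I ^ 9 := by
    have e1 : c ^ 5 = K' * (9 / 7) ^ 9 := by
      rw [hc, ← Real.rpow_natCast, ← Real.rpow_mul (by positivity)]; norm_num
    have e2 : (ν ^ (-(9 / 5 : ℝ))) ^ 5 = (ν ^ 9)⁻¹ := by
      rw [← Real.rpow_natCast, ← Real.rpow_mul hν.le,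
        show (-(9 / 5 : ℝ)) * ((5 : ℕ) : ℝ) = -((9 : ℕ) : ℝ) by norm_num,
        Real.rpow_neg hν.le, Real.rpow_natCast]
    have e3 : (B₄ ^ (6 / 5 : ℝ)) ^ 5 = B₄ ^ 6 := by
      rw [← Real.rpow_natCast, ← Real.rpow_mul hB₄,
        show (6 / 5 : ℝ) * ((5 : ℕ) : ℝ) = ((6 : ℕ) : ℝ) by norm_num, Real.rpow_natCast]
    have hν9 : ν ^ 9 ≠ 0 := pow_ne_zero 9 hν.ne'
    rw [hx, hy]
    simp only [mul_pow]
    rw [e1, e2, e3]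
    field_simp
  have hNle : |X| ≤ 9 / 14 * x + 5 / 14 * y :=
    VorticityL4.le_of_pow_fourteen_le (abs_nonneg X) hx0 hy0 (by rw [hxy]; exact h)
  rw [← hc, ← hy]
  have hxI : 9 / 14 * x = ν * I / 2 := by rw [hx]; ring
  nlinarith [hNle, hxI]

/-- **K0 row `ES.absS.q=4|T_LD|G1` HOLDS (∃κ), in the kernel, on `T³ = UnitAddTorus (Fin 3)`.** There
is a constant `κ` such that along every zero-mean classical solution of the unforced Navier–Stokes
equations on `T³` (`ν > 0`), at every time of the window, `s ↦ ∫|S(u(s))|⁴` is differentiable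
within the window and `d/dt ∫|S|⁴ ≤ κ · ν^{−9/5} · (2ℰ) · (∫|S|⁴)^{1+1/5}` — the cell's saturating
law `T_LD` with `σ = 5`, `γ = 9/5` for the strain moment (`Candidates.SaturatingLaw`,
`torusStrainMoment 4`). The constant is existential through the codomain-generic mean-zero Sobolev
constant, the strain Calderón–Zygmund constant at `s = 8` and the pressure-Hessian
Calderón–Zygmund constant at `q = 4`; an a priori inequality, small-data closing only.
[ours; strain twin of SIEVELD §3.2 (`q = 4`) with tree inputs] -/
theorem strainL4_saturatingLaw :
    ∃ κ : ℝ, SaturatingLaw (d := Fin 3) (torusStrainMoment 4) 5 (9 / 5) κ := by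
  obtain ⟨CT, hCT0, hCT⟩ := exists_strainSq_pow_six_le_cube
  obtain ⟨K, hK0, hK⟩ := exists_integral_gradSq_pow_four_le_strain
  obtain ⟨CP, hCP0, hCP⟩ := exists_integral_hess_pow_four_le (d := Fin 3)
  obtain ⟨KN, hKN⟩ : ∃ K' : ℝ, K' = 256 * (K + 1) ^ 4 * (CT + 1) ^ 3 := ⟨_, rfl⟩
  obtain ⟨KP, hKP⟩ : ∃ K' : ℝ, K' = 256 * ((729 : ℝ) * 9 * CP * K + 1) ^ 4 * (CT + 1) ^ 3 :=
    ⟨_, rfl⟩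
  have hKN0 : 0 ≤ KN := by rw [hKN]; positivity
  have hKP0 : 0 ≤ KP := by rw [hKP]; positivity
  obtain ⟨cN, hcN⟩ : ∃ c : ℝ, c = (KN * (9 / 7) ^ 9) ^ (1 / 5 : ℝ) := ⟨_, rfl⟩
  obtain ⟨cP, hcP⟩ : ∃ c : ℝ, c = (KP * (9 / 7) ^ 9) ^ (1 / 5 : ℝ) := ⟨_, rfl⟩
  have hcN0 : 0 ≤ cN := by rw [hcN]; positivity
  have hcP0 : 0 ≤ cP := by rw [hcP]; positivity
  refine ⟨5 / 7 * (cN + cP), ?_⟩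
  intro _ ν hν a b hab u p hsol hmean t ht
  have hut : IsSmooth (u t) := hsol.smooth_velocity.isSmooth_slice ht
  have hdiv : IsDivFree (u t) := hsol.divFree t ht
  have hF : (fun s => torusStrainMoment 4 (u s)) = fun s => ∫ x, torusStrainSqAt (u s) x ^ 2 := by
    funext s; exact torusStrainMoment_four (u s)
  obtain ⟨hdiff, hle⟩ := derivWithin_B4_le hab hν.le hsol ht
  refine ⟨by rw [hF]; exact hdiff, ?_⟩
  rw [hF]
  show _ ≤ 5 / 7 * (cN + cP) * ν ^ (-(9 / 5 : ℝ)) * (2 * torusEnstrophy (u t)) *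
      (torusStrainMoment 4 (u t)) ^ (1 + (5 : ℝ)⁻¹)
  -- opaque names for the slice quantities
  obtain ⟨XN, hXN⟩ : ∃ X : ℝ, X = ∫ x, torusStrainSqAt (u t) x * ∑ i, ∑ j,
      (partialDeriv j (u t) x i + partialDeriv i (u t) x j) / 2 *
        ∑ k, partialDeriv i (u t) x k * partialDeriv k (u t) x j := ⟨_, rfl⟩
  obtain ⟨XP, hXP⟩ : ∃ X : ℝ, X = ∫ x, torusStrainSqAt (u t) x * ∑ i, ∑ j,
      (partialDeriv j (u t) x i + partialDeriv i (u t) x j) / 2 *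
        partialDeriv i (partialDeriv j (p t)) x := ⟨_, rfl⟩
  obtain ⟨I, hI⟩ : ∃ I : ℝ, I = ∫ x, torusStrainSqAt (u t) x * ∑ k, ∑ i, ∑ j,
      ((partialDeriv k (partialDeriv j (u t)) x i +
        partialDeriv k (partialDeriv i (u t)) x j) / 2) ^ 2 := ⟨_, rfl⟩
  obtain ⟨B₄, hB₄⟩ : ∃ B : ℝ, B = ∫ x, torusStrainSqAt (u t) x ^ 2 := ⟨_, rfl⟩
  obtain ⟨B₂, hB₂⟩ : ∃ B : ℝ, B = ∫ x, torusStrainSqAt (u t) x := ⟨_, rfl⟩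
  rw [← hXN, ← hXP, ← hI] at hle
  have hQ0 := torusStrainSqAt_nonneg (u t)
  have hI0 : 0 ≤ I := by
    rw [hI]; exact integral_nonneg fun x => mul_nonneg (hQ0 x)
      (Finset.sum_nonneg fun k _ => Finset.sum_nonneg fun i _ => Finset.sum_nonneg fun j _ => sq_nonneg _)
  have hB₄0 : 0 ≤ B₄ := by rw [hB₄]; exact integral_nonneg fun x => by positivity
  have hB₂0 : 0 ≤ B₂ := by rw [hB₂]; exact integral_nonneg fun x => hQ0 x
  -- the two fourteen-power bounds
  have h14N : |XN| ^ 14 ≤ KN * B₄ ^ 6 * B₂ ^ 5 * I ^ 9 := by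
    rw [hKN, hXN, hB₄, hB₂, hI]
    exact nonlinear_production_bound hCT0 hK0 hCT hK hut hdiv
  have h14P : |XP| ^ 14 ≤ KP * B₄ ^ 6 * B₂ ^ 5 * I ^ 9 := by
    rw [hKP, hXP, hB₄, hB₂, hI]
    exact pressure_production_bound hCT0 hK0 hCP0 hCT hK hsol
      (fun s hs i j => hCP hab hsol s hs i j) ht
  have hYN := four_abs_le_of_pow_fourteen_le hKN0 hB₄0 hB₂0 hI0 hν h14N
  have hYP := four_abs_le_of_pow_fourteen_le hKP0 hB₄0 hB₂0 hI0 hν h14P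
  rw [← hcN] at hYN
  rw [← hcP] at hYP
  -- the budget in closed form
  have hbudget : 5 / 7 * (cN + cP) * ν ^ (-(9 / 5 : ℝ)) * (2 * torusEnstrophy (u t)) *
      (torusStrainMoment 4 (u t)) ^ (1 + (5 : ℝ)⁻¹) =
      10 / 7 * (cN * ν ^ (-(9 / 5 : ℝ)) * B₂ * B₄ ^ (6 / 5 : ℝ)) +
        10 / 7 * (cP * ν ^ (-(9 / 5 : ℝ)) * B₂ * B₄ ^ (6 / 5 : ℝ)) := by
    have e1 : torusEnstrophy (u t) = B₂ := by
      rw [hB₂, integral_strainSqAt_eq_torusEnstrophy hut hdiv]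
    have e2 : torusStrainMoment 4 (u t) = B₄ := by rw [torusStrainMoment_four, hB₄]
    rw [e1, e2, show (1 : ℝ) + (5 : ℝ)⁻¹ = 6 / 5 by norm_num]
    ring
  rw [hbudget]
  nlinarith [hYN, hYP, hle]

end StrainL4

end Summit.NavierStokesRegularity.FunctionalMining
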